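import Literature.MathematicalPhysics.QuantumFieldTheory.Balaban1983to89.Node00.TwoRunSiteSkeletons

/-!
# NODE 00 — THE SUP-DISTANCE CLOSENESS ON THE SITE TORUS: `SupNear ϱ z z′` (every coordinate of `z′ − z` is the cast of an integer of absolute value `≤ ϱ`), reflexive,
# symmetric, monotone in `ϱ`, containing `SiteTouch` at `ϱ = 1`, with covering number `(2ϱ+1)^d` — the canonical closeness `Nr` for the skeleton cover of
# `Node00/TwoRunSiteSkeletons` (blocks farther than `ϱ` apart in some coordinate, around the torus, are separated)

Cell `pub-ymgap`, YM-PLAN Track A (HUMAN RULING D-0062; width push D-0149); seat `pub-ymgap-dag-n20-d` (R134 (a) N20 NE7b s3 = the U5d ∕ `crOfRecord₁₃` lineage,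
its declarer) gen 34 — companion of `Node00/TwoRunSiteSkeletons` (gen 34, p739412: `exists_indep_dominating_subset`, `sepAnimalCoverFamily`,
`exists_mem_sepAnimalCoverFamily_siteTouch_of_hasBigComponent`, `card_sepAnimalCoverFamily_siteTouch_le` — all for an ABSTRACT reflexive symmetric closeness `Nr` with a
covering number `m`) and `Node00/TwoRunSitePeierlsCover` (`siteTouch_sub_mem`).  [LF-II] = [Balaban1989LargeFieldII]; [III] = [Balaban1988Convergent].

WHY.  The skeleton cover and the Summits-side Peierls assembly on skeletons (`…BalabanUVNodesSpineReadingOfRecord13CoPHKComponentSizeBlocksSkeleton{,Cond}`, gen 34) leave the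
closeness `Nr` and its covering number to the supplier.  Print's separation is METRIC: a large-field cube drags its enlargement into the region ([LF-II] (1.76) p. 381 — two
layers; p. 384 `S(Z) = Z′^{∼10}` — ten layers of the next cubes), so two cubes are independent sources of smallness exactly when they are farther apart than twice the enlargement
radius in the sup-metric of the cube lattice (a torus, [III] (2.1) p. 254).  This file supplies that closeness once and for all, so that a supplier names only a RADIUS:
* §1 `SupNear ϱ z z′ :↔ ∀ μ, ∃ δ : ℤ, |δ| ≤ ϱ ∧ z′ μ − z μ = ↑δ` (coordinatewise, around the torus); `supNear_refl`, `SupNear.symm`, `SupNear.mono`, `supNear_of_siteTouch`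
  (`SiteTouch ⇒ SupNear 1`), `supNear_zero_iff` (`ϱ = 0` is equality);
* §2 ★ `exists_cover_supNear` — the points `SupNear ϱ`-close to `z` are among the `(2ϱ+1)^d` translates `z − v`, `v ∈ (↑[−ϱ, ϱ])^d`: covering number `m = (2ϱ+1)^d`
  in the hypothesis shape `hm` of `Node00/TwoRunSiteSkeletons`;
* §3 the skeleton cover and its entropy AT THIS CLOSENESS, radius the only dial: ★★ `exists_mem_sepAnimalCoverFamily_supNear_of_hasBigComponent` (a `SiteTouch`-component of
  `≥ (2ϱ+1)^d · k` sites contains a `ϱ`-separated skeleton-connected `k`-set), ★ `card_sepAnimalCoverFamily_supNear_le` (`≤ |sites| · ((2ϱ+1)^d · 3^d · (2ϱ+1)^d)^{2(k−1)}`).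
HONEST — WHAT THIS IS NOT.  Pure finite torus combinatorics (one `def` = a relation; theorems); NO weight, NO measure, NO estimate; the enlargement radius of Bałaban's layer
calculus is NOT computed here (`ϱ` is a free dial); nothing of Bałaban's asserted; NE7 ∕ NE7b ∕ NE7c NOT PRINTED for `d = 4` and NOT proved; no node count moves (typed 28∕28 ·
discharged 8∕27); no `sorry`, no `axiom`, no `instance`, no `notation`; one finite four-torus programme at fixed `ε` — NOT ℝ⁴, NOT OS, NOT a mass gap, NOT the Clay problem.
-/

noncomputable section

open scoped BigOperators

namespace Literature.MathematicalPhysics.QuantumFieldTheory.Balaban1983to89.Node00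

open T4Continuum B14.Eq213MaximalDomains B15Eq112TorusCover B14DomainGeom B14.Eq218Concrete

variable {P : Params} {j : ℕ}

/-! ## §1  The closeness -/

/-- **SUP-DISTANCE `≤ ϱ` ON THE SITE TORUS**: every coordinate of `z′ − z` is the residue of an integer of absolute value at most `ϱ`.  (At `ϱ = 1` it contains `SiteTouch`;
the supplier of the skeleton letters takes `ϱ` = twice the enlargement radius of the layer calculus in blocks.)  The same notion as
`Literature.MathematicalPhysics.QuantumFieldTheory.SiteNear` of `BalabanFormatDensity` (stated there with `ZMod.val` on the abbrev torus `Site d L` of another route); restated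
on NODE 00's `Setup.Site P j` in the integer-residue form the covering count below uses, so that NODE 00 does not import that route's 2 000-line module — no equivalence is
claimed or needed here. [cite: Balaban1989LargeFieldII, (1.76) p.381, (1.84) p.386 (bookkeeping)] -/
def SupNear (ϱ : ℕ) (z z' : Site P j) : Prop :=
  ∀ μ : Fin P.d, ∃ δ : ℤ, |δ| ≤ ϱ ∧ z' μ - z μ = (δ : ZMod (P.sitesPerDir j))

/-- Unfolding. [cite: Balaban1989LargeFieldII, (1.84) p.386 (bookkeeping)] -/
theorem supNear_iff (ϱ : ℕ) (z z' : Site P j) : SupNear ϱ z z' ↔ ∀ μ : Fin P.d, ∃ δ : ℤ, |δ| ≤ ϱ ∧ z' μ - z μ = (δ : ZMod (P.sitesPerDir j)) :=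
  Iff.rfl

/-- Reflexive. [cite: Balaban1989LargeFieldII, (1.84) p.386 (bookkeeping)] -/
theorem supNear_refl (ϱ : ℕ) (z : Site P j) : SupNear ϱ z z := fun μ => ⟨0, by simp, by simp⟩

/-- Symmetric. [cite: Balaban1989LargeFieldII, (1.84) p.386 (bookkeeping)] -/
theorem SupNear.symm {ϱ : ℕ} {z z' : Site P j} (h : SupNear ϱ z z') : SupNear ϱ z' z := fun μ => by
  obtain ⟨δ, hδ, hzz⟩ := h μ
  refine ⟨-δ, by simpa using hδ, ?_⟩
  rw [Int.cast_neg, ← hzz, neg_sub]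

/-- Symmetric, as a two-way statement (the hypothesis shape `hsymm` of `Node00/TwoRunSiteSkeletons`). [cite: Balaban1989LargeFieldII, (1.84) p.386 (bookkeeping)] -/
theorem supNear_symm (ϱ : ℕ) (z z' : Site P j) : SupNear ϱ z z' → SupNear ϱ z' z := SupNear.symm

/-- Monotone in the radius. [cite: Balaban1989LargeFieldII, (1.84) p.386 (bookkeeping)] -/
theorem SupNear.mono {ϱ ϱ' : ℕ} (hle : ϱ ≤ ϱ') {z z' : Site P j} (h : SupNear ϱ z z') : SupNear ϱ' z z' := fun μ => by
  obtain ⟨δ, hδ, hzz⟩ := h μ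
  exact ⟨δ, hδ.trans (by exact_mod_cast hle), hzz⟩

/-- Touching sites are `1`-close. [cite: Balaban1989LargeFieldII, (1.84) p.386 (bookkeeping)] -/
theorem supNear_of_siteTouch {z z' : Site P j} (h : SiteTouch z z') : SupNear 1 z z' := fun μ => by
  rcases h μ with h0 | h1 | h2
  · exact ⟨0, by simp, by rw [h0]; simp⟩
  · exact ⟨1, by simp, by rw [h1]; simp⟩
  · exact ⟨-1, by simp, by rw [h2]; simp⟩

/-- Radius `0` is equality. [cite: Balaban1989LargeFieldII, (1.84) p.386 (bookkeeping)] -/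
theorem supNear_zero_iff (z z' : Site P j) : SupNear 0 z z' ↔ z = z' := by
  constructor
  · intro h
    funext μ
    obtain ⟨δ, hδ, hzz⟩ := h μ
    have hδ0 : δ = 0 := abs_nonpos_iff.1 (by exact_mod_cast hδ)
    rw [hδ0, Int.cast_zero, sub_eq_zero] at hzz
    exact hzz.symm
  · rintro rfl
    exact supNear_refl 0 z

/-! ## §2  The covering number `(2ϱ+1)^d` -/

/-- ★ **THE `ϱ`-NEIGHBOURHOOD OF A SITE HAS AT MOST `(2ϱ+1)^d` SITES**: the sites `ϱ`-close to `z` are among the translates `z − v` with `v` coordinatewise a residue of an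
integer in `[−ϱ, ϱ]` — the hypothesis shape `hm` of `Node00/TwoRunSiteSkeletons` with `m = (2ϱ+1)^d`. [cite: Balaban1989LargeFieldII, (1.84) p.386 (bookkeeping)] -/
theorem exists_cover_supNear (ϱ : ℕ) (z : Site P j) :
    ∃ s : Finset (Site P j), s.card ≤ (2 * ϱ + 1) ^ P.d ∧ ∀ z', SupNear ϱ z' z → z' ∈ s := by
  classical
  set I : Finset (ZMod (P.sitesPerDir j)) := (Finset.Icc (-(ϱ : ℤ)) (ϱ : ℤ)).image fun δ : ℤ => (δ : ZMod (P.sitesPerDir j)) with hI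
  have hIcard : I.card ≤ 2 * ϱ + 1 := by
    rw [hI]
    refine Finset.card_image_le.trans ?_
    rw [Int.card_Icc]
    omega
  refine ⟨(Fintype.piFinset fun _ : Fin P.d => I).image fun v => z - v, ?_, ?_⟩
  · calc ((Fintype.piFinset fun _ : Fin P.d => I).image fun v => z - v).card
        ≤ (Fintype.piFinset fun _ : Fin P.d => I).card := Finset.card_image_le
      _ = ∏ _μ : Fin P.d, I.card := Fintype.card_piFinset _
      _ ≤ (2 * ϱ + 1) ^ (Finset.univ : Finset (Fin P.d)).card := Finset.prod_le_pow_card _ _ _ fun _ _ => hIcard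
      _ = (2 * ϱ + 1) ^ P.d := by rw [Finset.card_univ, Fintype.card_fin]
  · intro z' hz'
    rw [Finset.mem_image]
    refine ⟨z - z', Fintype.mem_piFinset.2 fun μ => ?_, sub_sub_cancel z z'⟩
    obtain ⟨δ, hδ, hzz⟩ := hz' μ
    rw [hI, Finset.mem_image]
    refine ⟨δ, Finset.mem_Icc.2 (abs_le.1 hδ), ?_⟩
    rw [← hzz]
    rfl

/-! ## §3  The skeleton cover and its entropy at this closeness -/

/-- ★★ **THE SKELETON COVER AT RADIUS `ϱ`**: a large-field region `Z` of sites with a `SiteTouch`-component of `≥ thr lvl ≥ (2ϱ+1)^d · k` sites (`k ≥ 1`) contains the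
`ϱ`-separated skeleton-connected `k`-set of some member of `sepAnimalCoverFamily SiteTouch (SupNear ϱ) k`. [cite: Balaban1989LargeFieldII, (1.84)–(1.88) pp.386–387 (bookkeeping)] -/
theorem exists_mem_sepAnimalCoverFamily_supNear_of_hasBigComponent (ϱ : ℕ) {k : ℕ} (hk : 1 ≤ k) {thr : ℕ → ℕ} {lvl : ℕ}
    (hthr : (2 * ϱ + 1) ^ P.d * k ≤ thr lvl) {Z : Set (Site P j)} (h : HasBigComponent SiteTouch (bigOfCard thr lvl) Z) :
    ∃ p ∈ sepAnimalCoverFamily (SiteTouch (P := P) (j := j)) (SupNear (P := P) (j := j) ϱ) k, (↑p.2 : Set (Site P j)) ⊆ Z :=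
  exists_mem_sepAnimalCoverFamily_siteTouch_of_hasBigComponent (SupNear ϱ) (supNear_refl ϱ) (supNear_symm ϱ) (exists_cover_supNear ϱ) hk hthr h

/-- ★ **THE ENTROPY AT RADIUS `ϱ`**: the `ϱ`-separated skeleton family of `k`-sets has at most `|sites| · ((2ϱ+1)^d · 3^d · (2ϱ+1)^d)^{2(k−1)}` members.
[cite: Balaban1989LargeFieldII, (1.80) p.384, (1.84) p.386 (bookkeeping)] -/
theorem card_sepAnimalCoverFamily_supNear_le (ϱ : ℕ)
    [DecidableRel (touchingGraph (SkelTouch (SiteTouch (P := P) (j := j)) (SupNear (P := P) (j := j) ϱ))).Adj] (k : ℕ) :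
    (sepAnimalCoverFamily (SiteTouch (P := P) (j := j)) (SupNear (P := P) (j := j) ϱ) k).card ≤
      Fintype.card (Site P j) * ((2 * ϱ + 1) ^ P.d * 3 ^ P.d * (2 * ϱ + 1) ^ P.d) ^ (2 * (k - 1)) :=
  card_sepAnimalCoverFamily_siteTouch_le (SupNear ϱ) (supNear_symm ϱ) (exists_cover_supNear ϱ) k

/-! ## §4 (v1.1, APPEND-ONLY; every declaration above byte-identical)  The triangle inequality and layer growth: `n` touching layers around a `ϱ`-ball stay in the `(ϱ+n)`-ball —
the arithmetic a supplier uses to bound the CUMULATIVE enlargement radius of the layer calculus ([LF-II] (1.76) p.381: two layers; p.384 `S(Z) = Z′^{∼10}`: ten layers per step) -/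

/-- **TRIANGLE INEQUALITY**: `ϱ`-close then `ϱ′`-close is `(ϱ + ϱ′)`-close (coordinatewise the integer residues add). [cite: Balaban1989LargeFieldII, (1.76) p.381 (bookkeeping)] -/
theorem SupNear.add {ϱ ϱ' : ℕ} {x y z : Site P j} (h : SupNear ϱ x y) (h' : SupNear ϱ' y z) : SupNear (ϱ + ϱ') x z := fun μ => by
  obtain ⟨δ, hδ, hxy⟩ := h μ
  obtain ⟨δ', hδ', hyz⟩ := h' μ
  refine ⟨δ + δ', (abs_add_le δ δ').trans (by push_cast; linarith), ?_⟩
  rw [Int.cast_add, ← hxy, ← hyz]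
  ring

/-- **ONE TOUCHING LAYER ADDS ONE TO THE RADIUS**: a site touching a site `ϱ`-close to `x` is `(ϱ + 1)`-close to `x`. [cite: Balaban1989LargeFieldII, (1.76) p.381 (bookkeeping)] -/
theorem SupNear.siteTouch {ϱ : ℕ} {x y z : Site P j} (h : SupNear ϱ x y) (h' : SiteTouch y z) : SupNear (ϱ + 1) x z :=
  h.add (supNear_of_siteTouch h')

/-- **`n` TOUCHING LAYERS ADD `n` TO THE RADIUS**: along a touching path `y 0, y 1, …, y n` starting `ϱ`-close to `x`, the endpoint is `(ϱ + n)`-close to `x` — the cumulative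
radius of `n` enlargement layers. [cite: Balaban1989LargeFieldII, p.384 (bookkeeping)] -/
theorem SupNear.siteTouch_path {ϱ : ℕ} {x : Site P j} (n : ℕ) (y : ℕ → Site P j) (h0 : SupNear ϱ x (y 0)) (hstep : ∀ i < n, SiteTouch (y i) (y (i + 1))) :
    SupNear (ϱ + n) x (y n) := by
  induction n with
  | zero => simpa using h0
  | succ n ih =>
    have h := (ih fun i hi => hstep i (Nat.lt_succ_of_lt hi)).siteTouch (hstep n (Nat.lt_succ_self n))
    simpa [Nat.add_assoc] using h

/-- **SEPARATION BEYOND THE SUM OF RADII**: if `x` is NOT `(ϱ + ϱ′)`-close to `z`, no site is both `ϱ`-close to `x` and `ϱ′`-close to `z` — the `ϱ`-ball of `x` and the `ϱ′`-ball of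
`z` are disjoint (the form in which separated blocks have disjoint enlargement neighbourhoods). [cite: Balaban1989LargeFieldII, (1.84) p.386 (bookkeeping)] -/
theorem SupNear.not_near_of_not_add {ϱ ϱ' : ℕ} {x y z : Site P j} (h : ¬ SupNear (ϱ + ϱ') x z) (hy : SupNear ϱ x y) : ¬ SupNear ϱ' y z :=
  fun h' => h (hy.add h')

end Literature.MathematicalPhysics.QuantumFieldTheory.Balaban1983to89.Node00

end
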